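import Literature.Analysis.Calculus.SphereTangentialMean
import Mathlib.Algebra.QuadraticDiscriminant
import HarnessLib

/-!
# Cauchy–Schwarz for sphere integrals of products

Analysis support file (everything proved; no definitions, no named facts) for the `f₁`-chain of
A. Waldron, Invent. math. 217 (2019), §4.2 ((4.8): `(∂ₛf₁)² ≤ f₂²`, i.e. `⟨Ω, ∂ₛΩ⟩² ≤ |Ω|²|∂ₛΩ|²`
integrated): for continuous `f, g` off the origin and `r > 0`,
`(∮_{S_r} f g)² ≤ ∮_{S_r} f² · ∮_{S_r} g²` (`sphereIntegral_mul_sq_le`), via the discriminant of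
the nonnegative quadratic `t ↦ ∮ (t f + g)²`; and the pointwise-to-integral form
`(∮ h)² ≤ ∮ F · ∮ G` whenever `h² ≤ F G`, `0 ≤ F, G` pointwise (`sphereIntegral_sq_le_of_sq_le_mul`).

References: A. Waldron, Invent. math. 217 (2019), §4.2 [Waldron2019]; [folklore].
-/

noncomputable section

open scoped BigOperators
open MeasureTheory Metric Set
open Literature.Analysis.FluidPDE Literature.Analysis.Calculus

namespace Literature.Analysis.Calculus.MvPoly

variable {n : ℕ}

local notation "𝔼" => EuclideanSpace ℝ (Fin n)

/-- **Cauchy–Schwarz for sphere integrals**: `(∮ f g)² ≤ ∮ f² · ∮ g²`. [folklore] -/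
theorem sphereIntegral_mul_sq_le [Nontrivial 𝔼] {f g : 𝔼 → ℝ} (hf : ContinuousOn f {0}ᶜ)
    (hg : ContinuousOn g {0}ᶜ) {r : ℝ} (hr : 0 < r) :
    (sphereIntegral (volume : Measure 𝔼) (fun x => f x * g x) r) ^ 2 ≤
      sphereIntegral (volume : Measure 𝔼) (fun x => f x ^ 2) r *
        sphereIntegral (volume : Measure 𝔼) (fun x => g x ^ 2) r := by
  set A := sphereIntegral (volume : Measure 𝔼) (fun x => f x ^ 2) r with hA
  set B := sphereIntegral (volume : Measure 𝔼) (fun x => f x * g x) r with hB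
  set C := sphereIntegral (volume : Measure 𝔼) (fun x => g x ^ 2) r with hC
  -- `0 ≤ ∮ (t f + g)² = A t² + 2B t + C`
  have hquad : ∀ t : ℝ, 0 ≤ A * (t * t) + 2 * B * t + C := by
    intro t
    have hnn : 0 ≤ sphereIntegral (volume : Measure 𝔼) (fun x => (t * f x + g x) ^ 2) r :=
      sphereIntegral_nonneg' (fun x => sq_nonneg _) r
    have hexp : sphereIntegral (volume : Measure 𝔼) (fun x => (t * f x + g x) ^ 2) r =
        A * (t * t) + 2 * B * t + C := by
      have heq : (fun x : 𝔼 => (t * f x + g x) ^ 2) = fun x => (t ^ 2 * f x ^ 2 + 2 * t * (f x * g x)) + g x ^ 2 := by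
        funext x; ring
      rw [heq, sphereIntegral_add_of (fun x => t ^ 2 * f x ^ 2 + 2 * t * (f x * g x)) (fun x => g x ^ 2)
          ((continuousOn_const.mul (hf.pow 2)).add (continuousOn_const.mul (hf.mul hg))) (hg.pow 2) hr,
        sphereIntegral_add_of (fun x => t ^ 2 * f x ^ 2) (fun x => 2 * t * (f x * g x))
          (continuousOn_const.mul (hf.pow 2)) (continuousOn_const.mul (hf.mul hg)) hr,
        sphereIntegral_mul_left, sphereIntegral_mul_left]
      ring
    rw [hexp] at hnn
    exact hnn
  have hd := discrim_le_zero hquad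
  rw [discrim] at hd
  nlinarith [hd]

/-- **From a pointwise bound `h² ≤ F G` to `(∮ h)² ≤ ∮F · ∮G`** (`F, G ≥ 0`). [folklore] -/
theorem sphereIntegral_sq_le_of_sq_le_mul [Nontrivial 𝔼] {h F G : 𝔼 → ℝ} (hh : ContinuousOn h {0}ᶜ)
    (hF : ContinuousOn F {0}ᶜ) (hG : ContinuousOn G {0}ᶜ) (hF0 : ∀ x, 0 ≤ F x) (hG0 : ∀ x, 0 ≤ G x)
    (hpt : ∀ x, h x ^ 2 ≤ F x * G x) {r : ℝ} (hr : 0 < r) :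
    (sphereIntegral (volume : Measure 𝔼) h r) ^ 2 ≤
      sphereIntegral (volume : Measure 𝔼) F r * sphereIntegral (volume : Measure 𝔼) G r := by
  -- `|h| ≤ √F √G`
  have hsF : ContinuousOn (fun x => Real.sqrt (F x)) {0}ᶜ := hF.sqrt
  have hsG : ContinuousOn (fun x => Real.sqrt (G x)) {0}ᶜ := hG.sqrt
  have habs : ∀ x, |h x| ≤ Real.sqrt (F x) * Real.sqrt (G x) := by
    intro x
    rw [← Real.sqrt_mul (hF0 x), ← Real.sqrt_sq_eq_abs]
    exact Real.sqrt_le_sqrt (hpt x)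
  -- `|∮h| ≤ ∮|h| ≤ ∮ √F √G`
  have h1 : |sphereIntegral (volume : Measure 𝔼) h r| ≤
      sphereIntegral (volume : Measure 𝔼) (fun x => Real.sqrt (F x) * Real.sqrt (G x)) r := by
    have hup : sphereIntegral (volume : Measure 𝔼) h r ≤
        sphereIntegral (volume : Measure 𝔼) (fun x => Real.sqrt (F x) * Real.sqrt (G x)) r :=
      sphereIntegral_mono_of_norm hh (hsF.mul hsG) hr fun x _ => (le_abs_self _).trans (habs x)
    have hdown : sphereIntegral (volume : Measure 𝔼) (fun x => -h x) r ≤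
        sphereIntegral (volume : Measure 𝔼) (fun x => Real.sqrt (F x) * Real.sqrt (G x)) r :=
      sphereIntegral_mono_of_norm hh.neg (hsF.mul hsG) hr fun x _ => (neg_le_abs _).trans (habs x)
    have hneg : sphereIntegral (volume : Measure 𝔼) (fun x => -h x) r = -sphereIntegral (volume : Measure 𝔼) h r := by
      rw [sphereIntegral_def, sphereIntegral_def, integral_neg]
    rw [hneg] at hdown
    exact abs_le.2 ⟨by linarith, hup⟩
  -- Cauchy–Schwarz for `√F · √G`
  have h2 := sphereIntegral_mul_sq_le hsF hsG hr
  have hF2 : sphereIntegral (volume : Measure 𝔼) (fun x => Real.sqrt (F x) ^ 2) r = sphereIntegral (volume : Measure 𝔼) F r :=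
    sphereIntegral_congr_norm hr.le fun x _ => Real.sq_sqrt (hF0 x)
  have hG2 : sphereIntegral (volume : Measure 𝔼) (fun x => Real.sqrt (G x) ^ 2) r = sphereIntegral (volume : Measure 𝔼) G r :=
    sphereIntegral_congr_norm hr.le fun x _ => Real.sq_sqrt (hG0 x)
  rw [hF2, hG2] at h2
  have h3 : (sphereIntegral (volume : Measure 𝔼) h r) ^ 2 ≤
      (sphereIntegral (volume : Measure 𝔼) (fun x => Real.sqrt (F x) * Real.sqrt (G x)) r) ^ 2 := by
    have h0 : 0 ≤ sphereIntegral (volume : Measure 𝔼) (fun x => Real.sqrt (F x) * Real.sqrt (G x)) r :=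
      (abs_nonneg _).trans h1
    nlinarith [h1, abs_nonneg (sphereIntegral (volume : Measure 𝔼) h r), sq_abs (sphereIntegral (volume : Measure 𝔼) h r)]
  exact h3.trans h2

end Literature.Analysis.Calculus.MvPoly
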